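import Summits.AtomisticToContinuum.Crystallization.Theorems.OverbindingBudgetAffineRunCutAxialKernel
import Literature.MathematicalPhysics.StatisticalMechanics.HcpFccLatticeSumsEval
import Literature.MathematicalPhysics.StatisticalMechanics.HcpFccLatticeSumsTail

/-!
# `OverbindingBudget` / crux `RobustDefectLimitWindows` (stmt-AtomisticToContinuum-31280) — «RunCut» S3a: C₃ selection and the axial term

Support file (lens-4 g86, hand-in 2 part S3a for the competitor leaf **SW♭** `StackSwapGainFlat(Wide)`; memo `g86/memo/SW-G1.md` §2, pricing
`g85/memo/SW-S3.md` §2.2).  FIRST ORDER IN THE HOST STRAIN `S` of the TRIPLE move's column energy: of the six strain directions only `iso`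
(absorbed: the certificate is stated at the site's own scale) and the AXIAL one `zz = c/a` survive; the in-plane deviators `d1, d2` and the
out-of-plane shears `t1, t2` couple at first order through the lattice moments `∑ w(|x|²)·x₁`, `∑ w·x₂`, `∑ w·(x₁² − x₂²)`, `∑ w·x₁x₂` over the
aligned (`δ = 0`) and offset (`δ = 1`) triangular layer patterns, and THESE VANISH BY THE THREEFOLD SYMMETRY of both patterns about the moved
site's axis.

PART A — C₃ SELECTION (`tsum_c3_moment_eq_zero` + the four moments `c3_moment_x/y/dev/shear`).  The generator `(i,j) ↦ (−i−j−δ, i)`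
(`c3Map`; the rotation by `2π/3`: `u ↦ v − u`, `v ↦ −u`, `w ↦ w − u`) is a bijection of `ℤ²` of order three preserving the pattern form
`Q_δ` (`stackForm_c3Map`), and the coordinates `2x₁ = 2i + j + δ`, `2√3·x₂ = 3j + δ` of `i u + j v + δ w` have vanishing orbit sums, as do
`12(x₁² − x₂²) = 3(2i+j+δ)² − (3j+δ)²` and `4√3·x₁x₂ = (2i+j+δ)(3j+δ)`; hence `∑' g·P = 0` for every C₃-invariant summable weight `g`
(in particular every `G(Q_δ)`, e.g. `layerTerm δ n s`, `summable_layerTerm_mul`).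

PART B — THE AXIAL COEFFICIENT.  With `J_k(a, c) = (1/12)a⁻¹²J⁽⁶⁾(s) − (1/6)a⁻⁶J⁽³⁾(s)`, `s = k²c²/a²`, and `∂_s (Q+s)⁻ⁿ = −n(Q+s)⁻ⁿ⁻¹`, the
termwise derivative along `c ↦ c(1+ε)` at `k = 2` (`s = 8/3`) is `axialLJ a = (8/3)(a⁻⁶J⁽⁴⁾(8/3) − a⁻¹²J⁽⁷⁾(8/3))` (`axialLJ`; the Taylor
link to the finite strain is the hand-in-3 Taylor file, as for `κ`).  ENCLOSURES from the four kernel floor sums of `…RunCutAxialKernel`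
(box `40`, `M = 10¹⁸`, `boxFloorSum_sound_le/_ge`) and the crude in-plane tails `tsum_compl_box_le` of BOTH patterns (no second-difference
cancellation is needed at this precision; `registryCoupling_mem_of_box`):
  `0.000442513 ≤ J⁽⁴⁾(8/3) ≤ 0.000442569`,  `0.000118138 ≤ J⁽⁷⁾(8/3) ≤ 0.000118202`   (`registryCoupling_four_mem`, `_seven_mem`),
and from the wide box's left edge on, `21/25 ≤ a`: `0 ≤ axialLJ a ≤ 0.00111` (`axialLJ_mem_wide`), with the profile `axialLJ a ≤ (8/3)·0.000442569·a⁻⁶`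
(`axialLJ_le_profile`).  PRICE (memo §2): the TRIPLE column carries `4·axialLJ(a)·θ₀` at first order (`θ₀ = 10⁻³`): `3.66·10⁻⁶` at `a = 17/20`
(`1.1 %` of the certified gain `3.30·10⁻⁴`), `7.3·10⁻⁸` at `a = 2` (`1.6 %` of `4.68·10⁻⁶`); the layers `k ≥ 3` (`6·∑|∂_ε J_k|·θ₀`, exponentially
smaller) are enclosed in hand-in 3 by the same four-fact pattern per layer.
[this file: 3 definitions (`c3Map`, `c3Equiv`, `axialLJ`) + 16 theorems; standard axioms]
-/

noncomputable section

namespace Summit.AtomisticToContinuum.Crystallization.Theorems.OverbindingBudgetAffineRunCutAxial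

open Finset
open Literature.MathematicalPhysics.StatisticalMechanics.StackingSums
open Summit.AtomisticToContinuum.Crystallization.Theorems.OverbindingBudgetAffineRunCutAxialKernel

/-! ## Part A — the threefold symmetry of the layer patterns -/

/-- **The C₃ generator** on pattern indices: `(i, j) ↦ (−i − j − δ, i)` (rotation by `2π/3` about the axis; `u ↦ v − u`, `v ↦ −u`,
`w ↦ w − u`). [this file · kind: definition] -/
def c3Map (δ : ℕ) (ij : ℤ × ℤ) : ℤ × ℤ :=
  (-ij.1 - ij.2 - δ, ij.1)

/-- `c3Map` has order three. [folklore] -/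
theorem c3Map_three (δ : ℕ) (ij : ℤ × ℤ) : c3Map δ (c3Map δ (c3Map δ ij)) = ij := by
  obtain ⟨i, j⟩ := ij
  simp only [c3Map, Prod.mk.injEq]
  constructor <;> ring

/-- **The C₃ generator as a permutation of `ℤ²`.** [this file · kind: definition] -/
def c3Equiv (δ : ℕ) : ℤ × ℤ ≃ ℤ × ℤ where
  toFun := c3Map δ
  invFun := fun ij => c3Map δ (c3Map δ ij)
  left_inv := fun ij => c3Map_three δ ij
  right_inv := fun ij => c3Map_three δ ij

/-- The pattern form is C₃-invariant: `Q_δ(−i−j−δ, i) = Q_δ(i, j)`. [folklore] -/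
theorem stackForm_c3Map (δ : ℕ) (ij : ℤ × ℤ) : stackForm δ (c3Map δ ij).1 (c3Map δ ij).2 = stackForm δ ij.1 ij.2 := by
  obtain ⟨i, j⟩ := ij
  simp only [c3Map, stackForm]
  push_cast
  ring

/-- The layer term is C₃-invariant. [folklore] -/
theorem layerTerm_c3Map (δ n : ℕ) (s : ℝ) (ij : ℤ × ℤ) : layerTerm δ n s (c3Map δ ij) = layerTerm δ n s ij := by
  unfold layerTerm; rw [stackForm_c3Map]

/-- **Orbit cancellation**: a summable `f` on `ℤ²` whose C₃-orbit sums vanish has `∑' f = 0`. [folklore] -/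
theorem tsum_eq_zero_of_c3_orbit {δ : ℕ} (f : ℤ × ℤ → ℝ) (hf : Summable f)
    (h : ∀ ij, f ij + f (c3Map δ ij) + f (c3Map δ (c3Map δ ij)) = 0) : ∑' ij, f ij = 0 := by
  have e1 : ∑' ij, f (c3Map δ ij) = ∑' ij, f ij := (c3Equiv δ).tsum_eq f
  have e2 : ∑' ij, f (c3Map δ (c3Map δ ij)) = ∑' ij, f ij := ((c3Equiv δ).trans (c3Equiv δ)).tsum_eq f
  have hs1 : Summable fun ij => f (c3Map δ ij) := (c3Equiv δ).summable_iff.2 hf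
  have hs2 : Summable fun ij => f (c3Map δ (c3Map δ ij)) := ((c3Equiv δ).trans (c3Equiv δ)).summable_iff.2 hf
  have h0 : ∑' ij, (f ij + f (c3Map δ ij) + f (c3Map δ (c3Map δ ij))) = 0 := by
    rw [tsum_congr h]; exact tsum_zero
  rw [(hf.add hs1).tsum_add hs2, hf.tsum_add hs1, e1, e2] at h0
  linarith

/-- ★ **C₃ SELECTION RULE**: for a C₃-invariant weight `g` and a moment `P` with vanishing orbit sums, `∑' g·P = 0` (whenever summable).
[this file · kind: proof] -/
theorem tsum_c3_moment_eq_zero {δ : ℕ} (g P : ℤ × ℤ → ℝ) (hg : ∀ ij, g (c3Map δ ij) = g ij)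
    (hP : ∀ ij, P ij + P (c3Map δ ij) + P (c3Map δ (c3Map δ ij)) = 0) (hs : Summable fun ij => g ij * P ij) :
    ∑' ij, g ij * P ij = 0 := by
  refine tsum_eq_zero_of_c3_orbit (δ := δ) _ hs fun ij => ?_
  rw [hg (c3Map δ ij), hg ij, ← mul_add, ← mul_add, hP ij, mul_zero]

/-- **`x₁`-moment** (`2x₁ = 2i + j + δ`): `∑' g·(2i + j + δ) = 0`. [this file · kind: proof] -/
theorem c3_moment_x {δ : ℕ} (g : ℤ × ℤ → ℝ) (hg : ∀ ij, g (c3Map δ ij) = g ij)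
    (hs : Summable fun ij : ℤ × ℤ => g ij * (2 * (ij.1 : ℝ) + ij.2 + δ)) :
    ∑' ij : ℤ × ℤ, g ij * (2 * (ij.1 : ℝ) + ij.2 + δ) = 0 :=
  tsum_c3_moment_eq_zero g _ hg (fun ⟨i, j⟩ => by simp only [c3Map]; push_cast; ring) hs

/-- **`x₂`-moment** (`2√3·x₂ = 3j + δ`): `∑' g·(3j + δ) = 0`. [this file · kind: proof] -/
theorem c3_moment_y {δ : ℕ} (g : ℤ × ℤ → ℝ) (hg : ∀ ij, g (c3Map δ ij) = g ij)
    (hs : Summable fun ij : ℤ × ℤ => g ij * (3 * (ij.2 : ℝ) + δ)) :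
    ∑' ij : ℤ × ℤ, g ij * (3 * (ij.2 : ℝ) + δ) = 0 :=
  tsum_c3_moment_eq_zero g _ hg (fun ⟨i, j⟩ => by simp only [c3Map]; push_cast; ring) hs

/-- **Deviatoric moment** (`12(x₁² − x₂²) = 3(2i+j+δ)² − (3j+δ)²`): `∑' g·(3(2i+j+δ)² − (3j+δ)²) = 0` — no first-order `d1/d2` coupling.
[this file · kind: proof] -/
theorem c3_moment_dev {δ : ℕ} (g : ℤ × ℤ → ℝ) (hg : ∀ ij, g (c3Map δ ij) = g ij)
    (hs : Summable fun ij : ℤ × ℤ => g ij * (3 * (2 * (ij.1 : ℝ) + ij.2 + δ) ^ 2 - (3 * (ij.2 : ℝ) + δ) ^ 2)) :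
    ∑' ij : ℤ × ℤ, g ij * (3 * (2 * (ij.1 : ℝ) + ij.2 + δ) ^ 2 - (3 * (ij.2 : ℝ) + δ) ^ 2) = 0 :=
  tsum_c3_moment_eq_zero g _ hg (fun ⟨i, j⟩ => by simp only [c3Map]; push_cast; ring) hs

/-- **Shear moment** (`4√3·x₁x₂ = (2i+j+δ)(3j+δ)`): `∑' g·(2i+j+δ)(3j+δ) = 0` — no first-order `t1/t2` (and no `d`-type `x₁x₂`) coupling.
[this file · kind: proof] -/
theorem c3_moment_shear {δ : ℕ} (g : ℤ × ℤ → ℝ) (hg : ∀ ij, g (c3Map δ ij) = g ij)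
    (hs : Summable fun ij : ℤ × ℤ => g ij * ((2 * (ij.1 : ℝ) + ij.2 + δ) * (3 * (ij.2 : ℝ) + δ))) :
    ∑' ij : ℤ × ℤ, g ij * ((2 * (ij.1 : ℝ) + ij.2 + δ) * (3 * (ij.2 : ℝ) + δ)) = 0 :=
  tsum_c3_moment_eq_zero g _ hg (fun ⟨i, j⟩ => by simp only [c3Map]; push_cast; ring) hs

/-- `Q_δ = x₁² + x₂²` in the integer coordinates: `12·Q_δ = 3(2i+j+δ)² + (3j+δ)²` (`δ ≤ 1`). [folklore] -/
theorem twelve_stackForm_eq {δ : ℕ} (hδ : δ ≤ 1) (i j : ℤ) :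
    12 * stackForm δ i j = 3 * (2 * (i : ℝ) + j + δ) ^ 2 + (3 * (j : ℝ) + δ) ^ 2 := by
  have hd : ((δ : ℝ)) ^ 2 = δ := by
    interval_cases δ <;> norm_num
  unfold stackForm
  linear_combination (-4 : ℝ) * hd

/-- **Summability of the weighted layer terms**: a moment with `|P| ≤ 12·(Q_δ + s) + 12` against `layerTerm δ n s`, `n ≥ 3`, `s ≥ 0`, is summable
(dominated by `12·layerTerm δ (n−1) s + 12·layerTerm δ n s`).  All four moments above qualify (`|2x₁|, |2√3 x₂| ≤ 1 + 12Q`, `|12(x₁²−x₂²)|,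
|4√3 x₁x₂| ≤ 12Q`). [this file · kind: proof] -/
theorem summable_layerTerm_mul {δ : ℕ} (hδ : δ ≤ 1) {s : ℝ} (hs : 0 ≤ s) {n : ℕ} (hn : 3 ≤ n) (P : ℤ × ℤ → ℝ)
    (hP : ∀ ij : ℤ × ℤ, |P ij| ≤ 12 * (stackForm δ ij.1 ij.2 + s) + 12) :
    Summable fun ij => layerTerm δ n s ij * P ij := by
  obtain ⟨m, rfl⟩ : ∃ m, n = m + 1 := ⟨n - 1, by omega⟩
  have hg : Summable fun ij => 12 * layerTerm δ m s ij + 12 * layerTerm δ (m + 1) s ij :=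
    ((layerTerm_summable hδ hs (by omega)).mul_left 12).add ((layerTerm_summable hδ hs (by omega)).mul_left 12)
  refine Summable.of_norm_bounded hg fun ij => ?_
  rw [Real.norm_eq_abs, abs_mul, abs_of_nonneg (layerTerm_nonneg hδ _ hs ij)]
  have hQ : 0 ≤ stackForm δ ij.1 ij.2 + s := by have := stackForm_nonneg hδ ij.1 ij.2; linarith
  rcases hQ.eq_or_lt with hz | hpos
  · -- degenerate term: the layer term vanishes
    have : layerTerm δ (m + 1) s ij = 0 := by unfold layerTerm; rw [← hz]; simp
    rw [this, zero_mul]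
    have h1 := layerTerm_nonneg hδ m hs ij
    have h2 := layerTerm_nonneg hδ (m + 1) hs ij
    positivity
  · have e1 : layerTerm δ m s ij = layerTerm δ (m + 1) s ij * (stackForm δ ij.1 ij.2 + s) := by
      unfold layerTerm; rw [pow_succ, mul_assoc, inv_mul_cancel₀ hpos.ne', mul_one]
    rw [e1]
    have h2 := layerTerm_nonneg hδ (m + 1) hs ij
    nlinarith [mul_le_mul_of_nonneg_left (hP ij) h2]

/-! ## Part B — the axial (`c/a`) coefficient -/

/-- ★ **The axial coefficient** of the `k = 2` interlayer coupling: `axialLJ a = (8/3)·(a⁻⁶·J⁽⁴⁾(8/3) − a⁻¹²·J⁽⁷⁾(8/3))`, the termwise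
derivative of `J₂(a, c(1+ε))` at `ε = 0`. [this file · kind: definition] -/
def axialLJ (a : ℝ) : ℝ :=
  8 / 3 * ((a⁻¹) ^ 6 * registryCoupling 4 (8 / 3) - (a⁻¹) ^ 12 * registryCoupling 7 (8 / 3))

/-- **Registry coupling from box parts and crude tails**: with `0 ≤ tail_δ ≤ B_δ` (both patterns' box-complement tails),
`box₀ − box₁ − B₁ ≤ J⁽ⁿ⁾(s) ≤ box₀ − box₁ + B₀`. [this file · kind: proof] -/
theorem registryCoupling_mem_of_box {n : ℕ} (hn : 2 ≤ n) {s : ℝ} (hs : 0 ≤ s) (R : ℕ) {B₀ B₁ : ℝ}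
    (h0 : ∑' ij : {ij : ℤ × ℤ // ij ∉ box R}, layerTerm 0 n s ij ≤ B₀)
    (h1 : ∑' ij : {ij : ℤ × ℤ // ij ∉ box R}, layerTerm 1 n s ij ≤ B₁) :
    (∑ ij ∈ box R, layerTerm 0 n s ij) - (∑ ij ∈ box R, layerTerm 1 n s ij) - B₁ ≤ registryCoupling n s ∧
      registryCoupling n s ≤ (∑ ij ∈ box R, layerTerm 0 n s ij) - (∑ ij ∈ box R, layerTerm 1 n s ij) + B₀ := by
  unfold registryCoupling
  rw [layerSum_eq_sum_box_add_tsum_compl (δ := 0) (by norm_num) hs hn R,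
    layerSum_eq_sum_box_add_tsum_compl (δ := 1) le_rfl hs hn R]
  have t0 : 0 ≤ ∑' ij : {ij : ℤ × ℤ // ij ∉ box R}, layerTerm 0 n s ij :=
    tsum_nonneg fun ij => layerTerm_nonneg (by norm_num) n hs ij
  have t1 : 0 ≤ ∑' ij : {ij : ℤ × ℤ // ij ∉ box R}, layerTerm 1 n s ij :=
    tsum_nonneg fun ij => layerTerm_nonneg le_rfl n hs ij
  constructor <;> linarith

/-- ★ **`0.000442513 ≤ J⁽⁴⁾(8/3) ≤ 0.000442569`** (box `40` kernel floor sums, crude tails of both patterns). [this file · kind: proof] -/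
theorem registryCoupling_four_mem :
    0.000442513 ≤ registryCoupling 4 (8 / 3) ∧ registryCoupling 4 (8 / 3) ≤ 0.000442569 := by
  have h0 := boxFloorSum_sound_le (p := 2) (q := 3) (δ := 0) (by norm_num) (by norm_num) (by norm_num)
    2 40 4 (M := 10 ^ 18) (by norm_num)
  have h0' := boxFloorSum_sound_ge (p := 2) (q := 3) (δ := 0) (by norm_num) (by norm_num) (by norm_num)
    (k := 2) 40 (n := 4) (by norm_num) (Or.inl (by norm_num)) (M := 10 ^ 18) (by norm_num)
  have h1 := boxFloorSum_sound_le (p := 2) (q := 3) (δ := 1) (by norm_num) (by norm_num) (by norm_num)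
    2 40 4 (M := 10 ^ 18) (by norm_num)
  have h1' := boxFloorSum_sound_ge (p := 2) (q := 3) (δ := 1) (by norm_num) (by norm_num) (by norm_num)
    (k := 2) 40 (n := 4) (by norm_num) (Or.inl (by norm_num)) (M := 10 ^ 18) (by norm_num)
  rw [boxFloorSum_4_0_2] at h0 h0'
  rw [boxFloorSum_4_1_2] at h1 h1'
  have tl0 := tsum_compl_box_le (δ := 0) (by norm_num) (s := 8 / 3) (by norm_num) (d := 3) (by norm_num) (R := 40)
    (by norm_num)
  have tl1 := tsum_compl_box_le (δ := 1) le_rfl (s := 8 / 3) (by norm_num) (d := 3) (by norm_num) (R := 40)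
    (by norm_num)
  have henc := registryCoupling_mem_of_box (by norm_num) (by norm_num) 40 tl0 tl1
  norm_num at h0 h0' h1 h1' henc ⊢
  constructor <;> linarith [henc.1, henc.2]

/-- ★ **`0.000118138 ≤ J⁽⁷⁾(8/3) ≤ 0.000118202`** (box `40` kernel floor sums, crude tails of both patterns). [this file · kind: proof] -/
theorem registryCoupling_seven_mem :
    0.000118138 ≤ registryCoupling 7 (8 / 3) ∧ registryCoupling 7 (8 / 3) ≤ 0.000118202 := by
  have h0 := boxFloorSum_sound_le (p := 2) (q := 3) (δ := 0) (by norm_num) (by norm_num) (by norm_num)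
    2 40 7 (M := 10 ^ 18) (by norm_num)
  have h0' := boxFloorSum_sound_ge (p := 2) (q := 3) (δ := 0) (by norm_num) (by norm_num) (by norm_num)
    (k := 2) 40 (n := 7) (by norm_num) (Or.inl (by norm_num)) (M := 10 ^ 18) (by norm_num)
  have h1 := boxFloorSum_sound_le (p := 2) (q := 3) (δ := 1) (by norm_num) (by norm_num) (by norm_num)
    2 40 7 (M := 10 ^ 18) (by norm_num)
  have h1' := boxFloorSum_sound_ge (p := 2) (q := 3) (δ := 1) (by norm_num) (by norm_num) (by norm_num)
    (k := 2) 40 (n := 7) (by norm_num) (Or.inl (by norm_num)) (M := 10 ^ 18) (by norm_num)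
  rw [boxFloorSum_7_0_2] at h0 h0'
  rw [boxFloorSum_7_1_2] at h1 h1'
  have tl0 := tsum_compl_box_le (δ := 0) (by norm_num) (s := 8 / 3) (by norm_num) (d := 6) (by norm_num) (R := 40)
    (by norm_num)
  have tl1 := tsum_compl_box_le (δ := 1) le_rfl (s := 8 / 3) (by norm_num) (d := 6) (by norm_num) (R := 40)
    (by norm_num)
  have henc := registryCoupling_mem_of_box (by norm_num) (by norm_num) 40 tl0 tl1
  norm_num at h0 h0' h1 h1' henc ⊢
  constructor <;> linarith [henc.1, henc.2]

/-- **Profile**: `axialLJ a ≤ (8/3)·0.000442569·a⁻⁶` for `a > 0` (drop the `J⁽⁷⁾ > 0` term). [this file · kind: proof] -/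
theorem axialLJ_le_profile {a : ℝ} (ha : 0 < a) : axialLJ a ≤ 8 / 3 * (0.000442569 * (a⁻¹) ^ 6) := by
  obtain ⟨_, h4⟩ := registryCoupling_four_mem
  obtain ⟨h7, _⟩ := registryCoupling_seven_mem
  unfold axialLJ
  have hu : 0 ≤ (a⁻¹) ^ 6 := by positivity
  have hu2 : 0 ≤ (a⁻¹) ^ 12 := by positivity
  have h7' : (0 : ℝ) ≤ registryCoupling 7 (8 / 3) := by linarith
  nlinarith [mul_le_mul_of_nonneg_left h4 hu, mul_nonneg hu2 h7']

/-- ★ **THE AXIAL TERM ON THE WIDE BOX** (and beyond): `21/25 ≤ a ⇒ 0 ≤ axialLJ a ≤ 0.00111` (`u = a⁻⁶ ≤ (25/21)⁶ < 2.847`;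
`J⁽⁴⁾ − u·J⁽⁷⁾ > 0`; the concave maximum `(8/3)·J⁽⁴⁾²/(4J⁽⁷⁾) ≤ 0.001106`). [this file · kind: proof] -/
theorem axialLJ_mem_wide {a : ℝ} (ha1 : 21 / 25 ≤ a) : 0 ≤ axialLJ a ∧ axialLJ a ≤ 0.00111 := by
  obtain ⟨l4, h4⟩ := registryCoupling_four_mem
  obtain ⟨l7, h7⟩ := registryCoupling_seven_mem
  have ha0 : 0 < a := by linarith
  set u : ℝ := (a⁻¹) ^ 6 with hu
  have hu0 : 0 ≤ u := by positivity
  have hinv : a⁻¹ ≤ 25 / 21 := by rw [show (25 : ℝ) / 21 = (21 / 25)⁻¹ by norm_num]; exact inv_anti₀ (by norm_num) ha1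
  have hule : u ≤ 2.847 := by
    have := pow_le_pow_left₀ (by positivity : (0 : ℝ) ≤ a⁻¹) hinv 6
    rw [hu]; refine this.trans ?_; norm_num
  have e : axialLJ a = 8 / 3 * (u * registryCoupling 4 (8 / 3) - u ^ 2 * registryCoupling 7 (8 / 3)) := by
    unfold axialLJ; rw [hu]; ring
  rw [e]
  constructor
  · -- `J⁽⁴⁾ − u J⁽⁷⁾ ≥ 0.000442513 − 2.847·0.000118202 > 0`
    have : 0 ≤ registryCoupling 4 (8 / 3) - u * registryCoupling 7 (8 / 3) := by nlinarith
    nlinarith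
  · have step : u * registryCoupling 4 (8 / 3) - u ^ 2 * registryCoupling 7 (8 / 3) ≤ u * 0.000442569 - u ^ 2 * 0.000118138 := by
      nlinarith [mul_le_mul_of_nonneg_left h4 hu0, mul_le_mul_of_nonneg_left l7 (sq_nonneg u)]
    nlinarith [sq_nonneg (0.000118138 * u - 0.0002212845)]

end Summit.AtomisticToContinuum.Crystallization.Theorems.OverbindingBudgetAffineRunCutAxial

end
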